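import Summits.QuantumAdvantage.QuantumAdvantage.Theorems.SteerDialStateA

/-! # SteerDialState — part 2/2 (mechanical split for landing of `SteerDialState`; content verbatim; scopes re-opened with their variables) -/

set_option linter.style.longLine false
set_option linter.dupNamespace false

namespace Summit.QuantumAdvantage.QuantumAdvantage.Theorems.SteerDial
open Finset
open Literature.Computability.QuantumComplexity Literature.Computability.MetaComplexity
open Literature.Computability.QuantumComplexity.RingHLF
open Summit.QuantumAdvantage.AdviceFreeQNC0
open Summit.QuantumAdvantage.QuantumAdvantage.Theses

section State

variable {n D : ℕ}

/-- The state of `y` under the forms `v`: `st(y)_k = ℓ_{v_k}(y)`. -/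
def stv (v : Fin D → Fin n → ZMod 3) (y : Fin n → Bool) : Fin D → ZMod 3 := fun k => lform (v k) y

/-- A rotation-closedness witness makes `st(rot y)` a linear function of `st(y)`. -/
theorem stv_rot_one (v : Fin D → Fin n → ZMod 3) (A : Fin D → Fin D → ZMod 3)
    (hA : ∀ k i, rotCoef (v k) 1 i = ∑ k', A k k' * v k' i) (y : Fin n → Bool) (k : Fin D) :
    stv v (rot 1 y) k = ∑ k', A k k' * stv v y k' := by
  unfold stv
  rw [lform_rot_eq]
  simp_rw [hA, Finset.sum_mul]
  rw [Finset.sum_comm]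
  refine Finset.sum_congr rfl fun k' _ => ?_
  unfold lform
  rw [Finset.mul_sum]
  refine Finset.sum_congr rfl fun i _ => ?_
  ring

/-- Hence the state of every rotation of `y` is determined by the state of `y`. -/
theorem stv_rot_det (v : Fin D → Fin n → ZMod 3) (A : Fin D → Fin D → ZMod 3)
    (hA : ∀ k i, rotCoef (v k) 1 i = ∑ k', A k k' * v k' i) {y y' : Fin n → Bool}
    (h : stv v y = stv v y') : ∀ s : ℕ, stv v (rot s y) = stv v (rot s y')
  | 0 => by simpa [RingSymmetry.rot_zero] using h
  | s + 1 => by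
      have ih := stv_rot_det v A hA h s
      have e : ∀ z : Fin n → Bool, rot (s + 1) z = rot 1 (rot s z) := fun z => by
        rw [RingSymmetry.rot_rot, Nat.add_comm]
      rw [e, e]
      funext k
      rw [stv_rot_one v A hA, stv_rot_one v A hA, ih]

/-- For a union `E` of state fibres, `rcnt E` is a function of the state. -/
theorem rcnt_congr_of_stv (v : Fin D → Fin n → ZMod 3) (A : Fin D → Fin D → ZMod 3)
    (hA : ∀ k i, rotCoef (v k) 1 i = ∑ k', A k k' * v k' i) (E : Finset (Fin n → Bool))
    (hE : ∀ y y', stv v y = stv v y' → (y ∈ E ↔ y' ∈ E)) {y y' : Fin n → Bool} (h : stv v y = stv v y') :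
    rcnt E y = rcnt E y' := by
  unfold rcnt
  congr 1
  exact Finset.filter_congr fun s _ => hE _ _ (stv_rot_det v A hA h s.val)

/-- The indicator of one state as a product of `D` quadratic factors. -/
theorem stInd_eq (v : Fin D → Fin n → ZMod 3) (ν : Fin D → ZMod 3) (y : Fin n → Bool) :
    (∏ k, (1 - (lform (v k) y - ν k) ^ 2)) = if stv v y = ν then 1 else 0 := by
  rw [prod_one_sub_sq]
  by_cases h : stv v y = ν
  · rw [if_pos h, if_pos]
    intro k _
    have := congrFun h k
    simp only [stv] at this
    rw [this, sub_self]
  · rw [if_neg h, if_neg]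
    intro h'
    apply h
    funext k
    exact sub_eq_zero.mp (h' k (mem_univ k))

/-- The fibre indicator `1 − (ℓ_c − b)²` has degree `≤ 2`. -/
theorem indFactor0_mem_lowDeg (c : Fin n → ZMod 3) (b : ZMod 3) :
    (fun y => 1 - (lform c y - b) ^ 2 : Smolensky.CubeFn (ZMod 3) n) ∈ Smolensky.lowDeg (ZMod 3) n 2 := by
  have h := indFactor_mem_lowDeg c 0 b
  simp only [RingSymmetry.rot_zero] at h
  exact h

/-- Any union of state fibres has an indicator of degree `≤ 2D`. -/
theorem phiSt_mem_lowDeg (v : Fin D → Fin n → ZMod 3) (Hs : Finset (Fin D → ZMod 3)) :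
    (fun y => 1 - ∑ ν ∈ Hs, ∏ k, (1 - (lform (v k) y - ν k) ^ 2) : Smolensky.CubeFn (ZMod 3) n) ∈
      Smolensky.lowDeg (ZMod 3) n (D * 2) := by
  classical
  have heq : (fun y : Fin n → Bool => 1 - ∑ ν ∈ Hs, ∏ k, (1 - (lform (v k) y - ν k) ^ 2)) =
      (1 : Smolensky.CubeFn (ZMod 3) n) -
        ∑ ν ∈ Hs, ∏ k : Fin D, (fun y : Fin n → Bool => 1 - (lform (v k) y - ν k) ^ 2) := by
    funext y
    simp only [Pi.sub_apply, Pi.one_apply, Finset.sum_apply, Finset.prod_apply]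
  rw [heq]
  refine Submodule.sub_mem _ (Smolensky.one_mem_lowDeg (F := ZMod 3) (n := n) (D * 2)) ?_
  refine Submodule.sum_mem _ fun ν _ => ?_
  have := aff_prod_mem_lowDeg (N := n) (univ : Finset (Fin D))
    (fun k => fun y : Fin n → Bool => 1 - (lform (v k) y - ν k) ^ 2) (fun k _ => indFactor0_mem_lowDeg (v k) (ν k))
  simpa using this

/-- **STATE-TEST CORE** (body level, PROVED): for a union `E` of state fibres of a rotation-closed family of `D ≤ L^{c₀}`
forms with `#E ≤ (η_I/64)·2ⁿ`: a rotation list of length `T ≤ L²` and a rotation-invariant `φ` of degree `≤ L^{c₀+1}`,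
`(1−η_I)`-dense, with `#{φ = 1 ∧ ∀ t, rot^{r_t} y ∈ E} ≤ 2ⁿ/n^{k'}`. -/
theorem invModCover3_stateCore (ηI : ℝ) (k' c₀ : ℕ) :
    ∃ n₀ : ℕ, ∀ n ≥ n₀, ∀ D : ℕ, D ≤ (Nat.log 2 n) ^ c₀ →
      ∀ (v : Fin D → Fin n → ZMod 3) (A : Fin D → Fin D → ZMod 3),
        (∀ k i, rotCoef (v k) 1 i = ∑ k', A k k' * v k' i) →
        ∀ E : Finset (Fin n → Bool), (∀ y y', stv v y = stv v y' → (y ∈ E ↔ y' ∈ E)) →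
          (E.card : ℝ) ≤ ηI / 64 * 2 ^ n →
          ∃ T : ℕ, T ≤ (Nat.log 2 n) ^ 2 ∧ ∃ r : Fin T → ℕ,
            ∃ φ : Smolensky.CubeFn (ZMod 3) n,
              φ ∈ Smolensky.lowDeg (ZMod 3) n ((Nat.log 2 n) ^ (c₀ + 1)) ∧ (∀ y, φ (rot 1 y) = φ y) ∧
              (1 - ηI) * (2 : ℝ) ^ n ≤ ((univ.filter fun y : Fin n → Bool => φ y = 1).card : ℝ) ∧
              ((univ.filter fun y : Fin n → Bool => φ y = 1 ∧ ∀ t, rot (r t) y ∈ E).card : ℝ) ≤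
                1 / (n : ℝ) ^ k' * (2 : ℝ) ^ n := by
  classical
  refine ⟨2 ^ (k' + 3), ?_⟩
  intro n hn D hD v A hA E hE hEcard
  set L := Nat.log 2 n with hL
  have hLk : k' + 3 ≤ L := by rw [hL]; exact Nat.le_log_of_pow_le (by norm_num) hn
  have hn1 : 1 ≤ n := le_trans Nat.one_le_two_pow hn
  have hn0 : 0 < n := hn1
  set T := k' * (L + 1) with hT
  have hTL : T ≤ L ^ 2 := by rw [hT]; nlinarith [hLk]
  have hnT : n ^ k' ≤ 64 ^ T := by
    have hnL : n < 2 ^ (L + 1) := by rw [hL]; exact Nat.lt_pow_succ_log_self (by norm_num) n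
    calc n ^ k' ≤ (2 ^ (L + 1)) ^ k' := Nat.pow_le_pow_left hnL.le k'
      _ = 2 ^ T := by rw [← pow_mul, hT, Nat.mul_comm]
      _ ≤ 64 ^ T := Nat.pow_le_pow_left (by norm_num) T
  have hu : ((univ : Finset (Fin n → Bool)).card : ℝ) = (2 : ℝ) ^ n := by simp
  have hnpos : (0 : ℝ) < (n : ℝ) ^ k' := by
    have : (0 : ℝ) < n := by exact_mod_cast hn1
    positivity
  obtain ⟨r, hr⟩ := exists_rotList hn0 E T
  -- the heavy states and φ := 1 − 1_heavy, written as a polynomial of the state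
  let heavy : (Fin n → Bool) → Prop := fun y => n ≤ 64 * rcnt E y
  set Hs : Finset (Fin D → ZMod 3) := (univ.filter fun y => heavy y).image (stv v) with hHs
  have hHs_iff : ∀ y, stv v y ∈ Hs ↔ heavy y := by
    intro y
    constructor
    · intro hy
      rw [hHs, Finset.mem_image] at hy
      obtain ⟨y', hy', he⟩ := hy
      have hh : heavy y' := (Finset.mem_filter.mp hy').2
      show n ≤ 64 * rcnt E y
      rw [rcnt_congr_of_stv v A hA E hE he.symm]
      exact hh
    · intro hy
      rw [hHs]
      exact Finset.mem_image_of_mem _ (Finset.mem_filter.mpr ⟨mem_univ _, hy⟩)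
  set φ : Smolensky.CubeFn (ZMod 3) n := fun y =>
    1 - ∑ ν ∈ Hs, ∏ k, (1 - (lform (v k) y - ν k) ^ 2) with hφ
  have hφval : ∀ y, φ y = if heavy y then 0 else 1 := by
    intro y
    have e1 : φ y = 1 - ∑ ν ∈ Hs, ∏ k, (1 - (lform (v k) y - ν k) ^ 2) := by rw [hφ]
    rw [e1]
    simp_rw [stInd_eq]
    rw [Finset.sum_ite_eq]
    by_cases hy : heavy y
    · rw [if_pos ((hHs_iff y).mpr hy), if_pos hy, sub_self]
    · rw [if_neg (fun h => hy ((hHs_iff y).mp h)), if_neg hy, sub_zero]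
  have hφ1 : ∀ y, φ y = 1 ↔ ¬ heavy y := by
    intro y
    rw [hφval y]
    by_cases hy : heavy y
    · rw [if_pos hy]; exact ⟨fun h0 => absurd h0 (by decide), fun h => absurd hy h⟩
    · rw [if_neg hy]; exact ⟨fun _ => hy, fun _ => rfl⟩
  refine ⟨T, hTL, r, φ, ?_, ?_, ?_, ?_⟩
  · -- degree ≤ 2D ≤ L^{c₀+1}
    have h2 := phiSt_mem_lowDeg v Hs
    have hle : D * 2 ≤ L ^ (c₀ + 1) := by
      have hL2 : 2 ≤ L := by omega
      calc D * 2 ≤ L ^ c₀ * L := Nat.mul_le_mul hD hL2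
        _ = L ^ (c₀ + 1) := by ring
    exact Smolensky.lowDeg_mono hle h2
  · -- rotation invariance
    intro y
    rw [hφval, hφval]
    have : heavy (rot 1 y) ↔ heavy y := by
      show n ≤ 64 * rcnt E (rot 1 y) ↔ n ≤ 64 * rcnt E y
      rw [rcnt_rot]
    by_cases hy : heavy y
    · rw [if_pos hy, if_pos (this.mpr hy)]
    · rw [if_neg hy, if_neg (fun h => hy (this.mp h))]
  · -- density: #{φ = 1} = 2ⁿ − #heavy ≥ 2ⁿ − 64·#E
    have hH := card_heavy_le hn0 E
    have hsplit := Finset.card_filter_add_card_filter_not (s := (univ : Finset (Fin n → Bool))) (fun y => heavy y)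
    have heq : (univ.filter fun y : Fin n → Bool => φ y = 1) = univ.filter fun y => ¬ heavy y :=
      Finset.filter_congr fun y _ => hφ1 y
    rw [heq]
    have h1 : (((univ.filter fun y : Fin n → Bool => heavy y).card : ℕ) : ℝ) +
        ((univ.filter fun y : Fin n → Bool => ¬ heavy y).card : ℝ) = (2 : ℝ) ^ n := by
      rw [← hu]; exact_mod_cast hsplit
    have h2 : (((univ.filter fun y : Fin n → Bool => heavy y).card : ℕ) : ℝ) ≤ 64 * (E.card : ℝ) := by
      exact_mod_cast hH
    nlinarith
  · -- the bad set
    have heq : (univ.filter fun y : Fin n → Bool => φ y = 1 ∧ ∀ t, rot (r t) y ∈ E) =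
        univ.filter fun y => ¬ heavy y ∧ ∀ t, rot (r t) y ∈ E :=
      Finset.filter_congr fun y _ => by rw [hφ1]
    rw [heq]
    have h2 : (univ.filter fun y : Fin n → Bool => ¬ heavy y ∧ ∀ t, rot (r t) y ∈ E).card * n ^ k' ≤ 2 ^ n :=
      le_trans (Nat.mul_le_mul_left _ hnT) (by rw [Nat.mul_comm]; exact hr)
    have h3 : ((univ.filter fun y : Fin n → Bool => ¬ heavy y ∧ ∀ t, rot (r t) y ∈ E).card : ℝ) *
        (n : ℝ) ^ k' ≤ (2 : ℝ) ^ n := by exact_mod_cast h2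
    rw [one_div, inv_mul_eq_div, le_div_iff₀ hnpos]
    exact h3

/-- **The workshop hinge `InvModCover3` RESTRICTED TO STATE TESTS holds** (statement = the hinge with the test
quantifier `∀ ψ ∈ lowDeg` replaced by `ψ := [st(x|_{[0,n)}) ∉ M]` for the state `st ∈ 𝔽₃^D` of `D ≤ (log₂ n)^c` linear
forms spanning a rotation-closed space (witness `A`) and an ARBITRARY set `M` of rejected states, every other quantifier
verbatim; `η := η_I/4096`, `m := 6`, words `W0`, `c₁ := 2`, `c' := c + 1`; from `invModCover3_stateCore`). -/
theorem steerDial_invModCover3State :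
  ∀ ηI : ℝ, 0 < ηI → ∃ η : ℝ, 0 < η ∧ ∀ k' : ℕ, ∃ m : ℕ, 1 ≤ m ∧ ∃ c₁ : ℕ, ∀ c : ℕ, ∃ c' : ℕ, ∃ n₀ : ℕ,
    ∀ n ≥ n₀, ∀ D : ℕ, D ≤ (Nat.log 2 n) ^ c → ∀ (v : Fin D → Fin n → ZMod 3) (A : Fin D → Fin D → ZMod 3),
      (∀ k i, rotCoef (v k) 1 i = ∑ k', A k k' * v k' i) → ∀ M : Finset (Fin D → ZMod 3),
    ∀ ψ : Smolensky.CubeFn (ZMod 3) (n + m),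
      (∀ x, ψ x = if (fun k => lform (v k) (fun i => x (Fin.castAdd m i))) ∈ M then 0 else 1) →
      (1 - η) * (2 : ℝ) ^ (n + m) ≤ ((univ.filter fun x : Fin (n + m) → Bool => ψ x = 1).card : ℝ) →
        ∃ T : ℕ, T ≤ (Nat.log 2 n) ^ c₁ ∧ ∃ r : Fin T → ℕ, ∃ u α β : Fin T → Fin m → Bool,
          ∃ a b : Fin T → Bool, (∀ t, wordCert (u t) (α t) (β t) (a t) (b t) = true) ∧
          ∃ φ : Smolensky.CubeFn (ZMod 3) n, φ ∈ Smolensky.lowDeg (ZMod 3) n ((Nat.log 2 n) ^ c') ∧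
            (∀ y : Fin n → Bool, φ (rot 1 y) = φ y) ∧
            (1 - ηI) * (2 : ℝ) ^ n ≤ ((univ.filter fun y : Fin n → Bool => φ y = 1).card : ℝ) ∧
            ((univ.filter fun y : Fin n → Bool =>
                φ y = 1 ∧ ∀ t : Fin T, ψ (pad (u t) (rot (r t) y)) ≠ 1).card : ℝ) ≤
              1 / (n : ℝ) ^ k' * (2 : ℝ) ^ n := by
  classical
  intro ηI hηI
  refine ⟨ηI / 4096, by positivity, fun k' => ⟨6, by norm_num, 2, fun c => ⟨c + 1, ?_⟩⟩⟩
  obtain ⟨n₀, hcore⟩ := invModCover3_stateCore ηI k' c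
  refine ⟨n₀, ?_⟩
  intro n hn D hD v A hA M ψ hψ hdens
  set E : Finset (Fin n → Bool) := univ.filter fun y => stv v y ∈ M with hE
  have hEdef : ∀ y, y ∈ E ↔ stv v y ∈ M := fun y => by simp [hE]
  have hEst : ∀ y y', stv v y = stv v y' → (y ∈ E ↔ y' ∈ E) := fun y y' h => by rw [hEdef, hEdef, h]
  have hψne : ∀ x, ψ x ≠ 1 ↔ stv v (fun i => x (Fin.castAdd 6 i)) ∈ M := by
    intro x
    rw [hψ x]
    by_cases h : stv v (fun i => x (Fin.castAdd 6 i)) ∈ M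
    · have h' : (fun k => lform (v k) (fun i => x (Fin.castAdd 6 i))) ∈ M := h
      rw [if_pos h']
      exact ⟨fun _ => h, fun _ => by decide⟩
    · have h' : ¬ (fun k => lform (v k) (fun i => x (Fin.castAdd 6 i))) ∈ M := h
      rw [if_neg h']
      exact ⟨fun h1 => absurd rfl h1, fun h2 => absurd h2 h⟩
  have hEcard : (E.card : ℝ) ≤ ηI / 64 * 2 ^ n := by
    have h1 : E.card ≤ (univ.filter fun x : Fin (n + 6) → Bool => ψ x ≠ 1).card := by
      refine Finset.card_le_card_of_injOn (pad W0) (fun z hz => ?_) (fun z _ z' _ hzz => ?_)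
      · simp only [mem_coe, mem_filter, mem_univ, true_and] at hz ⊢
        rw [hψne]
        have hb : (fun i => pad W0 z (Fin.castAdd 6 i)) = z := funext fun i => pad_castAdd W0 z i
        rw [hb]
        exact (hEdef z).mp hz
      · funext i
        have := congrFun hzz (Fin.castAdd 6 i)
        simpa [pad_castAdd] using this
    have h2 := Finset.card_filter_add_card_filter_not (s := (univ : Finset (Fin (n + 6) → Bool)))
      (fun x => ψ x = 1)
    have hu : (univ : Finset (Fin (n + 6) → Bool)).card = 2 ^ (n + 6) := by simp
    rw [hu] at h2
    have h3 : ((univ.filter fun x : Fin (n + 6) → Bool => ψ x = 1).card : ℝ) +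
        ((univ.filter fun x : Fin (n + 6) → Bool => ¬ ψ x = 1).card : ℝ) = (2 : ℝ) ^ (n + 6) := by
      exact_mod_cast h2
    have h4 : (E.card : ℝ) ≤ ((univ.filter fun x : Fin (n + 6) → Bool => ¬ ψ x = 1).card : ℝ) := by
      exact_mod_cast h1
    have h5 : (2 : ℝ) ^ (n + 6) = 2 ^ n * 64 := by rw [pow_add]; norm_num
    rw [h5] at h3 hdens
    nlinarith
  obtain ⟨T, hTL, r, φ, hdeg, hinv, hdense, hbad⟩ := hcore n hn D hD v A hA E hEst hEcard
  refine ⟨T, hTL, r, fun _ => W0, fun _ => A0, fun _ => B0, fun _ => false, fun _ => false,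
    fun _ => wordCert_W0, φ, hdeg, hinv, hdense, ?_⟩
  have hset : (univ.filter fun y : Fin n → Bool => φ y = 1 ∧ ∀ t : Fin T, ψ (pad W0 (rot (r t) y)) ≠ 1) =
      (univ.filter fun y : Fin n → Bool => φ y = 1 ∧ ∀ t, rot (r t) y ∈ E) := by
    ext y
    simp only [mem_filter, mem_univ, true_and]
    refine and_congr_right fun _ => forall_congr' fun t => ?_
    rw [hψne, hEdef]
    have hb : (fun i => pad W0 (rot (r t) y) (Fin.castAdd 6 i)) = rot (r t) y := funext fun i => pad_castAdd W0 _ i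
    rw [hb]
  dsimp only
  rw [hset]
  exact hbad

end State

end Summit.QuantumAdvantage.QuantumAdvantage.Theorems.SteerDial
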